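import Mathlib.AlgebraicTopology.FundamentalGroupoid.FundamentalGroup
import Mathlib.GroupTheory.Index
import Mathlib.AlgebraicGeometry.Morphisms.Etale
import Mathlib.AlgebraicGeometry.Morphisms.Finite
import Literature.AlgebraicGeometry.Motives.AlgPoints
import Literature.AlgebraicGeometry.Motives.BaseChange
import Literature.AlgebraicGeometry.HodgeTheory.GlobalInvariantCycles
import HarnessLib

/-!
# Riemann's existence theorem with descent to `ℚ̄`: finite-index subgroups of `π₁(S(ℂ), s)` are realised by finite étale covers defined over `ℚ̄` (named fact)

Topic `Literature/AlgebraicGeometry/FundamentalGroup`; cite item `wi-32541` (family `hodge`), the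
covering input of Voisin's finite-monodromy step (crux `FiniteMonodromyAlgebraicOfQbar`,
`stmt-HodgeConjecture-15380`, of route `HodgeConjecture/PeriodDeficiency`; layer-2 child
`RiemannExistenceQbarDescent`). It is stated in EXACTLY the shape of the hypothesis `hRE` of the
tree's assembled proof
`Literature.AlgebraicGeometry.HodgeTheory.voisin2007_algebraic_of_finite_monodromyOrbit_of_qbar_of_classical_inputs`
(`HodgeTheory/HodgeGenericQbarDescentProofs.lean`), strengthened by the clause `IsFinite g₀.left`
(the cover IS finite; needed downstream by
`HodgeTheory.exists_smoothProjective_baseChangeHom_compactification_familyPullback`), and the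
un-strengthened shape is recovered by the proved projection
`riemannExistence_qbarDescent_of_finiteIndex.hRE`.

## The statement and its classical sources

For `σ : ℚ̄ →+* ℂ`, a smooth irreducible quasi-projective `ℚ̄`-scheme `S₀` with complexification
`S = S₀ ⊗_σ ℂ`, a point `s ∈ S(ℂ)` and a finite-index subgroup `H ≤ π₁(S(ℂ), s)` (topological
fundamental group of the complex points with their analytic topology, `Motives.ComplexPoints`),
there are a FINITE ÉTALE `g₀ : S₀' ⟶ S₀` over `ℚ̄` with `S₀'` quasi-projective and `S₀' ⊗_σ ℂ`
irreducible, and a point `s' ∈ S₀'(ℂ)` over `s`, such that `g(ℂ)` maps every loop at `s'` to a loop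
whose class lies in `H`. This is the conjunction of the following printed theorems (no more is
claimed):

1. *Classification of covering spaces* [HatcherAT2002, Thm. 1.38 with Prop. 1.36 and Prop. 1.32]:
   `S(ℂ)` is a connected complex manifold (`S` smooth, and irreducible as the base change of the
   irreducible `S₀` along the algebraically closed `ℚ̄`; `S(ℂ)` connected by [SGA1, Exp. XII
   Prop. 2.4], the tree's `Motives.ComplexPoints.connectedSpace_iff_holds`), hence path-connected,
   locally path-connected and semilocally simply-connected, so `H` is `p_*π₁(T, t)` for a connected
   covering `p : (T, t) → (S(ℂ), s)` whose number of sheets is the index `[π₁ : H] < ∞`.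
2. *Riemann's existence theorem* [SGA1, Exp. XII Thm. 5.1 (p. 333): for `X` locally of finite type
   over `ℂ`, `X' ↦ X'^an` is an equivalence between finite étale covers of `X` and finite étale
   covers of `X^an`; Cor. 5.2 (p. 337): `π₁^ét(X) =` profinite completion of `π₁(X^an)`]: the finite
   covering `T` is `S'(ℂ)` for a finite étale `S' → S`, connected since `T` is.
3. *Descent along `ℚ̄ ⊂ ℂ`* [SGA1, Exp. XIII Prop. 4.6 (pp. 421–422), Künneth formula
   `π₁(X ×_k Y) ⥲ π₁(X) × π₁(Y)` for `k` separably closed, `X`, `Y` connected `k`-schemes, `X`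
   quasi-compact quasi-separated, finite-type `k̄`-schemes strongly desingularisable — true in
   characteristic `0` by Hironaka; with `k = ℚ̄`, `X = S₀`, `Y = Spec ℂ`, `π₁(Spec ℂ) = 1`]:
   `FEt(S₀) → FEt(S₀ ⊗_σ ℂ)` is an equivalence, so the connected `S' → S` is `S₀' ⊗_σ ℂ → S` for a
   (connected) finite étale `g₀ : S₀' ⟶ S₀`.
4. *Integrality of the cover* [SGA1, Exp. I Prop. 10.1 with Cor. 9.10: a connected scheme étale and
   separated over a normal connected scheme is integral; `S` is normal, being smooth over `ℂ`]:
   `S₀' ⊗_σ ℂ ≅ S'` is irreducible.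
5. *Quasi-projectivity* [EGAII, Cor. 6.1.11 (a finite morphism is projective) with Prop. 5.3.4 (ii)]:
   `S₀'`, finite over the quasi-projective `S₀`, is quasi-projective over `ℚ̄`.

The base point `s'` is the point of `S₀'(ℂ) ≃ S'(ℂ) ≃ T` corresponding to `t`, and the loop clause
is `g(ℂ)_* π₁(S₀'(ℂ), s') = p_* π₁(T, t) = H` (only `⊆` is stated, as consumed).

## Design notes

* Carriers are the tree's: `Motives.SchemeOver`, the base-change functor `Motives.baseChangeHom σ`,
  complex points `Motives.ComplexPoints` with the analytic topology and the functorial continuous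
  maps `Motives.AlgPoints.map`, `HodgeTheory.IsQuasiProjectiveOver`; the fundamental group is
  Mathlib's `FundamentalGroup` of the subspace `Set.univ ⊆ S(ℂ)` at `⟨s, _⟩` (the form used by the
  consumer, whose monodromy transport lives on `Set.univ`), loops are pushed forward with
  `Path.map` and re-based with `Path.cast` along `g(ℂ) s' = s`.
* Mathlib has covering maps (`IsCoveringMap`) and `FundamentalGroup` but neither the classification
  of coverings nor the étale fundamental group / Riemann existence (searched: `UniversalCover`,
  `SemilocallySimplyConnected`, `RiemannExistence`: nothing relevant); the tree has the
  covering-space-shaped companion inputs `hRiemann`/`hDescent`/`hFinQP` only as HYPOTHESES of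
  `HodgeTheory.finiteCovering_descends_to_qbar_of_riemannExistence` (no declaration). Deriving the
  present finite-index form from those three would still need item 1 (classification of coverings),
  so the fact is vendored whole, in the consumed shape.
* Only `⊆ H` and only existence are asserted (no uniqueness, no Galois correspondence, no equality
  of the image with `H`), exactly what the consumer destructures.

## References

* [SGA1] A. Grothendieck, M. Raynaud, *Revêtements étales et groupe fondamental (SGA 1)*, LNM 224
  (1971) / arXiv:math/0206203: Exp. I Prop. 10.1, Cor. 9.10; Exp. XII Prop. 2.4, Thm. 5.1, Cor. 5.2;
  Exp. XIII Prop. 4.6. Read via `lit read arxiv:math/0206203` (files p0021, p0184–0185, p0218).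
* [HatcherAT2002] A. Hatcher, *Algebraic Topology*, CUP 2002, §1.3: Prop. 1.32 (sheets = index),
  Prop. 1.36, Thm. 1.38 (classification of covering spaces).
* [EGAII] A. Grothendieck, *ÉGA II*, Publ. Math. IHÉS 8 (1961), Prop. 5.3.4 (ii), Cor. 6.1.11.
* C. Voisin, *Hodge loci and absolute Hodge classes*, Compositio Math. 143 (2007), §3, proof of
  Prop. 0.7 ("there is an étale cover `S''` of the smooth part of `S'`, also defined over `ℚ̄`, on
  which this monodromy action becomes trivial") — the consumer.
-/

noncomputable section

open CategoryTheory AlgebraicGeometry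
open _root_.Topology

namespace Literature.AlgebraicGeometry.FundamentalGroup

open Literature.AlgebraicGeometry.Motives Literature.AlgebraicGeometry.HodgeTheory

/-- **Riemann's existence theorem with descent to `ℚ̄`, finite-index form.** For `σ : ℚ̄ →+* ℂ`
and a smooth irreducible quasi-projective `ℚ̄`-scheme `S₀`, every finite-index subgroup `H` of
`π₁(S(ℂ), s)`, `S = S₀ ⊗_σ ℂ`, is realised by a FINITE ÉTALE `g₀ : S₀' ⟶ S₀` defined over `ℚ̄`
with `S₀'` quasi-projective and `S₀' ⊗_σ ℂ` irreducible, together with a complex point `s'` of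
`S₀'` over `s` such that `g(ℂ)` maps every loop at `s'` into `H`:
the covering of `S(ℂ)` attached to `H` (classification of coverings of the connected manifold
`S(ℂ)`, finitely many sheets `= [π₁ : H]`) is `S'(ℂ)` for a connected finite étale `S' → S`
(Riemann's existence theorem, SGA1 XII Thm. 5.1 / Cor. 5.2), which descends to a finite étale
`S₀' → S₀` (SGA1 XIII Prop. 4.6 with `Y = Spec ℂ`: `π₁(S₀ ⊗_{ℚ̄} ℂ) ⥲ π₁(S₀)` in characteristic
`0`); `S₀' ⊗_σ ℂ ≅ S'` is integral (SGA1 I Prop. 10.1: connected, étale separated over the normal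
connected `S`) and `S₀'` is quasi-projective (EGA II Cor. 6.1.11, Prop. 5.3.4 (ii)). The shape is
verbatim the hypothesis `hRE` of
`HodgeTheory.voisin2007_algebraic_of_finite_monodromyOrbit_of_qbar_of_classical_inputs` with the
extra conjunct `IsFinite g₀.left` (see `riemannExistence_qbarDescent_of_finiteIndex.hRE`).
[cite: SGA1, Exp. XII Thm. 5.1 (p. 333) and Cor. 5.2 (p. 337); Exp. XIII Prop. 4.6 (pp. 421–422); Exp. I Prop. 10.1]
[cite: HatcherAT2002, Thm. 1.38 with Prop. 1.36 and Prop. 1.32 (classification of covering spaces)]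
[cite: EGAII, Cor. 6.1.11 with Prop. 5.3.4 (ii)] -/
def riemannExistence_qbarDescent_of_finiteIndex : Prop :=
  ∀ (σ : AlgebraicClosure ℚ →+* ℂ) (S₀ : Motives.SchemeOver (AlgebraicClosure ℚ)),
    IsQuasiProjectiveOver S₀ → IrreducibleSpace S₀.left → AlgebraicGeometry.Smooth S₀.hom →
    ∀ (s : Motives.ComplexPoints ((Motives.baseChangeHom σ).obj S₀))
      (H : Subgroup (_root_.FundamentalGroup
        (Set.univ : Set (Motives.ComplexPoints ((Motives.baseChangeHom σ).obj S₀)))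
          ⟨s, Set.mem_univ s⟩)), H.FiniteIndex →
      ∃ (S₀' : Motives.SchemeOver (AlgebraicClosure ℚ)) (g₀ : S₀' ⟶ S₀)
        (s' : Motives.ComplexPoints ((Motives.baseChangeHom σ).obj S₀'))
        (hs : Motives.AlgPoints.map ((Motives.baseChangeHom σ).map g₀) s' = s),
        IsQuasiProjectiveOver S₀' ∧ IrreducibleSpace ((Motives.baseChangeHom σ).obj S₀').left ∧
        AlgebraicGeometry.Etale g₀.left ∧ IsFinite g₀.left ∧
        ∀ γ' : Path (⟨s', Set.mem_univ s'⟩ :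
            (Set.univ : Set (Motives.ComplexPoints ((Motives.baseChangeHom σ).obj S₀'))))
            ⟨s', Set.mem_univ s'⟩,
          _root_.FundamentalGroup.fromPath
            (⟦(γ'.map ((((Motives.AlgPoints.continuous_map ((Motives.baseChangeHom σ).map g₀)).comp
                continuous_subtype_val)).subtype_mk fun _ ↦ Set.mem_univ _)).cast
              (Subtype.ext hs.symm) (Subtype.ext hs.symm)⟧) ∈ H

/-- The hypothesis `hRE` of
`HodgeTheory.voisin2007_algebraic_of_finite_monodromyOrbit_of_qbar_of_classical_inputs`, verbatim
(the fact with the finiteness conjunct dropped). [cite: SGA1, Exp. XII Thm. 5.1 and Exp. XIII Prop. 4.6] -/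
theorem riemannExistence_qbarDescent_of_finiteIndex.hRE
    (h : riemannExistence_qbarDescent_of_finiteIndex) :
    ∀ (σ : AlgebraicClosure ℚ →+* ℂ) (S₀ : Motives.SchemeOver (AlgebraicClosure ℚ)),
      IsQuasiProjectiveOver S₀ → IrreducibleSpace S₀.left → AlgebraicGeometry.Smooth S₀.hom →
      ∀ (s : Motives.ComplexPoints ((Motives.baseChangeHom σ).obj S₀))
        (H : Subgroup (_root_.FundamentalGroup
          (Set.univ : Set (Motives.ComplexPoints ((Motives.baseChangeHom σ).obj S₀)))
            ⟨s, Set.mem_univ s⟩)), H.FiniteIndex →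
        ∃ (S₀' : Motives.SchemeOver (AlgebraicClosure ℚ)) (g₀ : S₀' ⟶ S₀)
          (s' : Motives.ComplexPoints ((Motives.baseChangeHom σ).obj S₀'))
          (hs : Motives.AlgPoints.map ((Motives.baseChangeHom σ).map g₀) s' = s),
          IsQuasiProjectiveOver S₀' ∧ IrreducibleSpace ((Motives.baseChangeHom σ).obj S₀').left ∧
          AlgebraicGeometry.Etale g₀.left ∧
          ∀ γ' : Path (⟨s', Set.mem_univ s'⟩ :
              (Set.univ : Set (Motives.ComplexPoints ((Motives.baseChangeHom σ).obj S₀'))))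
              ⟨s', Set.mem_univ s'⟩,
            _root_.FundamentalGroup.fromPath
              (⟦(γ'.map ((((Motives.AlgPoints.continuous_map ((Motives.baseChangeHom σ).map g₀)).comp
                  continuous_subtype_val)).subtype_mk fun _ ↦ Set.mem_univ _)).cast
                (Subtype.ext hs.symm) (Subtype.ext hs.symm)⟧) ∈ H := by
  intro σ S₀ hqp hirr hsm s H hH
  obtain ⟨S₀', g₀, s', hs, hqp', hirr', het, -, hloops⟩ := h σ S₀ hqp hirr hsm s H hH
  exact ⟨S₀', g₀, s', hs, hqp', hirr', het, hloops⟩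

/-- The finiteness-and-étaleness part alone: every finite-index `H ≤ π₁(S(ℂ), s)` yields SOME finite
étale `g₀ : S₀' ⟶ S₀` over `ℚ̄` with `S₀'` quasi-projective, `S₀' ⊗_σ ℂ` irreducible and a complex
point over `s` (forget the loop clause). [cite: SGA1, Exp. XII Thm. 5.1 and Exp. XIII Prop. 4.6] -/
theorem riemannExistence_qbarDescent_of_finiteIndex.exists_isFinite_etale
    (h : riemannExistence_qbarDescent_of_finiteIndex)
    (σ : AlgebraicClosure ℚ →+* ℂ) (S₀ : Motives.SchemeOver (AlgebraicClosure ℚ))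
    (hqp : IsQuasiProjectiveOver S₀) (hirr : IrreducibleSpace S₀.left)
    (hsm : AlgebraicGeometry.Smooth S₀.hom)
    (s : Motives.ComplexPoints ((Motives.baseChangeHom σ).obj S₀))
    (H : Subgroup (_root_.FundamentalGroup
      (Set.univ : Set (Motives.ComplexPoints ((Motives.baseChangeHom σ).obj S₀))) ⟨s, Set.mem_univ s⟩))
    (hH : H.FiniteIndex) :
    ∃ (S₀' : Motives.SchemeOver (AlgebraicClosure ℚ)) (g₀ : S₀' ⟶ S₀)
      (s' : Motives.ComplexPoints ((Motives.baseChangeHom σ).obj S₀')),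
      Motives.AlgPoints.map ((Motives.baseChangeHom σ).map g₀) s' = s ∧
      IsQuasiProjectiveOver S₀' ∧ IrreducibleSpace ((Motives.baseChangeHom σ).obj S₀').left ∧
      AlgebraicGeometry.Etale g₀.left ∧ IsFinite g₀.left := by
  obtain ⟨S₀', g₀, s', hs, hqp', hirr', het, hfin, -⟩ := h σ S₀ hqp hirr hsm s H hH
  exact ⟨S₀', g₀, s', hs, hqp', hirr', het, hfin⟩

end Literature.AlgebraicGeometry.FundamentalGroup

end
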